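import Literature.AnabelianGeometry.SemiGraphs.PSCNumericallyCuspidalOfRankProofs
import Literature.AnabelianGeometry.SemiGraphs.PSCGraphicityEasyDirections
import Literature.AnabelianGeometry.SemiGraphs.PSCSmoothCurveGenuineCuspidal
import Literature.AnabelianGeometry.SemiGraphs.PSCSmoothCurveGenuineCuspRankLevels
import HarnessLib

/-!
# [CombGC] Theorem 1.6 (ii) at node-free data: the direct cuspidal route from four inputs

Mochizuki, *A combinatorial version of the Grothendieck conjecture*, Tohoku Math. J. **59** (2007)
[CombGC], Theorem 1.6 (ii), author's ms p. 13: "`α` is graphic if and only if it is graphically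
filtration-preserving"; proof p. 14: "sufficiency … by Proposition 1.3 [Remark 1.3.1] … `α` is
numerically cuspidal … [Theorem 1.6 (i)] group-theoretically cuspidal … [Proposition 1.5 (ii)] graphic".
FACT-LIST row F-0444 `GraphicIffFiltrationPreservingHolds` (abc-iut cell, layer L3, L-F pack C; seat
abc-iut-L3-t4 gen 5).  PROOF-ONLY (0 definitions).

The tree's general closer for (ii), `graphicIffFiltrationPreservingHolds_of_inputs''` (abc-iut-w5-d174),
consumes THIRTEEN origin statements (sturdy covers, compactification Rmk. 1.1.6, duality of ranks, pro-`l`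
images, nodal ramification …) because at general pointed stable curves `M^edge ≠ M^cusp`; it is instanced
at the covering-closed pro-`ℓ` genuine smooth-curve origin by abc-iut-w5-d174's
`exists_smoothCurveGenuineProLOrigin_thm16_inputs_hold` (the instance of record for F-0444 there).  At
NODE-FREE data (one vertex `Π_v = Π_G`, no nodes, any cusps) `M^edge_{G_U} = M^cusp_{G_U}`
(`edgeFil_eq_cuspFil_of_isEmpty`) and the printed recipe collapses to its cuspidal core — a second,
hypothesis-light route:

* `isNumericallyCuspidal_of_isEdgewiseFiltrationPreserving_of_cuspRank` — node-free `G`, `H` on profinite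
  groups, Rmk. 1.3.1's `CuspRank` and `NoncuspidalIffCuspFilTrivial` for `G` and for `H` ALONE (no
  `IsSturdy`, no `DualityRankEq`, no common prime: `Σ_G`, `Σ_H` arbitrary): every edge-wise
  filtration-preserving `α` is numerically cuspidal.  Route: `α(cuspFil_G U) = cuspFil_H(α U)`, so the
  continuous hom-counts of `M^cusp_{G_U}`, `M^cusp_{H_{αU}}` to every `ℤ/p` agree; for `p ∈ Σ` the count is
  `p^{r−1}` (cusp rank) or `1` (`M^cusp = 0`), for `p ∉ Σ` it is `1`
  (`natCard_continuousMonoidHom_zmod_eq_one_of_not_mem`); the noncuspidality criterion moves `r = 0`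
  across `α`.
* `graphicIffGraphicallyFiltrationPreserving_of_nodeFree` / `graphicIffFiltrationPreservingHolds_of_nodeFree`
  — (ii) at one pair, resp. F-0444 AS TYPED over every origin of node-free one-vertex data on profinite
  groups, from FOUR named inputs: `RankStatementsHold` (F-3098; its `CuspRank`/`NoncuspidalIffCuspFilTrivial`
  conjuncts), `NumericallyCuspidalIffHolds` (F-0458), `GraphicIffEdgeLikeVerticialHolds` (F-0443); necessity
  is abc-iut-L5-t6's `isGraphicallyFiltrationPreserving_of_isGraphic`.
* `graphicIffFiltrationPreservingHolds_of_smoothCurveGenuine` — all four inputs are THEOREMS at every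
  pro-`ℓ` origin of GENUINE smooth-curve data (abc-iut-w5-d195's shape; `rankStatementsHold_of_smoothCurveGenuine`,
  `numericallyCuspidalIffHolds_of_smoothCurve'`, `graphicIffEdgeLikeVerticialHolds_of_smoothCurve'`), so
  F-0444 HOLDS there in CLOSURE-FREE form: only the outward shape of `Ω` is used (no `hin`: `Ω` need not be
  closed under coverings, sturdy covers or compactification — e.g. an origin holding one tripod datum).

HONEST SCOPE: a derivation of the typed Thm. 1.6 (ii) from named inputs at node-free data, and
consistency / non-vacuity evidence at genuine smooth curves with cusps; not the printed theorem for all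
pointed stable curves (nodes are exactly what this route does not treat); nothing here takes a side on
[IUTchIII] Cor. 3.12. [cite: MochizukiCombGC2007, Thm 1.6(ii) pp.13-14] [cite: MochizukiCombGC2007, Rmk 1.3.1 p.10]
-/


noncomputable section

namespace Literature.AnabelianGeometry.SemiGraphs

open Literature.AnabelianGeometry.Anabelioids (IsSigmaInteger)

universe u

/-! ### Pro-`Σ` subquotients have no continuous characters of order prime to `Σ` -/

namespace SemiGraphOfAnabelioids.IsProSigmaCompletion

variable {P : Type*} [Group P] [TopologicalSpace P] [IsTopologicalGroup P] [CompactSpace P]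
  [TotallyDisconnectedSpace P] {Sigma : Set ℕ}

/-- **For a prime `l ∉ Σ`, a subquotient `E/N` of a profinite pro-`Σ` group has exactly ONE continuous
homomorphism to `ℤ/l`** (the trivial one): the kernel of such a homomorphism is an open subgroup of
`E/N`, whose index — a `Σ`-integer (`isSigmaInteger_index_quotient_subgroupOf`) — is the order of the
image, a divisor of `l`. [cite: MochizukiSemiAnbd2006, Def. 2.9(i) p.31] -/
theorem natCard_continuousMonoidHom_zmod_eq_one_of_not_mem
    (hP : ∀ M : Subgroup P, M.Normal → IsOpen (M : Set P) → IsSigmaInteger Sigma M.index)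
    (E : Subgroup P) (N : Subgroup E) [N.Normal] {l : ℕ} (hl : l.Prime) (hlS : l ∉ Sigma) :
    Nat.card {F : (E ⧸ N) →* Multiplicative (ZMod l) //
      @Continuous _ (Multiplicative (ZMod l)) _ ⊥ F} = 1 := by
  letI : TopologicalSpace (Multiplicative (ZMod l)) := ⊥
  haveI : DiscreteTopology (Multiplicative (ZMod l)) := ⟨rfl⟩
  haveI : NeZero l := ⟨hl.ne_zero⟩
  haveI : Unique {F : (E ⧸ N) →* Multiplicative (ZMod l) // Continuous F} :=
    { default := ⟨1, continuous_const⟩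
      uniq := fun F => by
        apply Subtype.ext
        -- the kernel is open, of `Σ`-integer index `= #range F ∣ l`
        have hko : IsOpen ((F.1.ker : Subgroup (E ⧸ N)) : Set (E ⧸ N)) := by
          rw [MonoidHom.coe_ker]
          exact (isOpen_discrete _).preimage F.2
        have hidx := isSigmaInteger_index_quotient_subgroupOf hP E N F.1.ker hko
        rw [Subgroup.index_ker] at hidx
        have hdvd : Nat.card F.1.range ∣ l := by
          have h := Subgroup.card_subgroup_dvd_card F.1.range
          rwa [Nat.card_congr Multiplicative.toAdd, Nat.card_zmod] at h
        rcases (Nat.dvd_prime hl).mp hdvd with h1 | hl'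
        · exact MonoidHom.range_eq_bot_iff.mp (Subgroup.eq_bot_of_card_eq _ h1)
        · have hmem : l ∈ Sigma := hidx.2 l hl (by simp only [hl', dvd_refl])
          exact absurd hmem hlS }
  exact Nat.card_unique

end SemiGraphOfAnabelioids.IsProSigmaCompletion

namespace PSCDatum

open scoped Pointwise
open SemiGraphOfAnabelioids (IsProSigmaCompletion)
open SemiGraphOfAnabelioids.IsProSigmaCompletion
open Literature.GroupTheory.CombinatorialGroupTheory
open Literature.GroupTheory.CombinatorialGroupTheory.PuncturedSurfaceGroup (cuspInertia IsHyperbolicType)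

variable {P : Type u} [Group P] [TopologicalSpace P] [IsTopologicalGroup P]
variable {P' : Type u} [Group P'] [TopologicalSpace P'] [IsTopologicalGroup P']

/-! ### Node-free data: `α` edge-wise filtration-preserving transports `M^cusp` level by level -/

section NodeFree

/-- An isomorphism of topological groups carries `cl[U,U]` to `cl[α U, α U]` (copy of the private lemma
of `PSCNumericallyCuspidalOfRankProofs.lean`). [folklore] -/
private theorem map_closure_commutator' (α : P ≃ₜ* P') (U : Subgroup P) :
    ((⁅U, U⁆).topologicalClosure).map α.toMulEquiv.toMonoidHom =
      (⁅U.map α.toMulEquiv.toMonoidHom, U.map α.toMulEquiv.toMonoidHom⁆).topologicalClosure := by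
  rw [← Subgroup.map_commutator]
  apply SetLike.coe_injective
  rw [Subgroup.coe_map, Subgroup.topologicalClosure_coe, Subgroup.topologicalClosure_coe,
    Subgroup.coe_map]
  exact α.toHomeomorph.image_closure _

/-- **No nodes: an edge-wise filtration-preserving `α` carries `cuspFil_G U` onto `cuspFil_H (α U)`**
(`M^edge = M^cusp` on both sides, `edgeFil_eq_cuspFil_of_isEmpty`). [cite: MochizukiCombGC2007, Def 1.4(iii) p.10] -/
theorem map_cuspFil_eq_of_isEdgewiseFiltrationPreserving {G : PSCDatum P} {H : PSCDatum P'}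
    [IsEmpty G.graph.N] [IsEmpty H.graph.N] {α : P ≃ₜ* P'} (hα : G.IsEdgewiseFiltrationPreserving H α)
    {U : Subgroup P} (hU : IsOpen (U : Set P)) :
    (G.cuspFil U).map α.toMulEquiv.toMonoidHom = H.cuspFil (U.map α.toMulEquiv.toMonoidHom) := by
  rw [← G.edgeFil_eq_cuspFil_of_isEmpty, ← H.edgeFil_eq_cuspFil_of_isEmpty]
  exact hα U hU

variable [CompactSpace P] [TotallyDisconnectedSpace P] [CompactSpace P'] [TotallyDisconnectedSpace P']
variable {G : PSCDatum P} {H : PSCDatum P'} {α : P ≃ₜ* P'}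

omit [TotallyDisconnectedSpace P] [CompactSpace P'] in
/-- **Invariance of `#Hom_cts(M^cusp, Q)` under an edge-wise filtration-preserving `α` between NODE-FREE
data**: for every open `U ≤ Π_G` and every topological group `Q`,
`#Hom_cts(M^cusp_{G_U}, Q) = #Hom_cts(M^cusp_{H_{α U}}, Q)` — the two subquotients are isomorphic
topological groups.  No sturdiness, no duality of ranks. [cite: MochizukiCombGC2007, Thm 1.6(ii) p.14] -/
theorem natCard_cuspFil_eq_of_isEdgewiseFiltrationPreserving_of_isEmpty [IsEmpty G.graph.N]
    [IsEmpty H.graph.N] (hα : G.IsEdgewiseFiltrationPreserving H α) {U : Subgroup P}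
    (hU : IsOpen (U : Set P)) [((⁅U, U⁆.topologicalClosure).subgroupOf (G.cuspFil U)).Normal]
    [((⁅U.map α.toMulEquiv.toMonoidHom, U.map α.toMulEquiv.toMonoidHom⁆.topologicalClosure).subgroupOf
      (H.cuspFil (U.map α.toMulEquiv.toMonoidHom))).Normal]
    (Q : Type*) [Group Q] [TopologicalSpace Q] :
    Nat.card {F : (G.cuspFil U ⧸ (⁅U, U⁆.topologicalClosure).subgroupOf (G.cuspFil U)) →* Q //
        Continuous F} =
      Nat.card {F : (H.cuspFil (U.map α.toMulEquiv.toMonoidHom) ⧸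
        (⁅U.map α.toMulEquiv.toMonoidHom, U.map α.toMulEquiv.toMonoidHom⁆.topologicalClosure).subgroupOf
          (H.cuspFil (U.map α.toMulEquiv.toMonoidHom))) →* Q // Continuous F} :=
  natCard_continuousMonoidHom_subquotient_congr α (map_closure_commutator' α U)
    (map_cuspFil_eq_of_isEdgewiseFiltrationPreserving hα hU) (Subgroup.isClosed_topologicalClosure _)
    (Subgroup.isClosed_topologicalClosure _) Q

omit [CompactSpace P] [TotallyDisconnectedSpace P] [CompactSpace P'] [TotallyDisconnectedSpace P'] in
/-- If `M^cusp_{G_U} = 0` (`cuspFil U = cl[U,U]`), its hom-count to `ℤ/p` is `1` for EVERY prime `p`.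
[cite: MochizukiCombGC2007, Rmk 1.3.1 p.10] -/
theorem natCard_cuspFil_zmod_eq_one_of_eq (G : PSCDatum P) {U : Subgroup P}
    [((⁅U, U⁆.topologicalClosure).subgroupOf (G.cuspFil U)).Normal]
    (h : G.cuspFil U = (⁅U, U⁆).topologicalClosure) (p : ℕ) :
    Nat.card {F : (G.cuspFil U ⧸ (⁅U, U⁆.topologicalClosure).subgroupOf (G.cuspFil U)) →*
      Multiplicative (ZMod p) // @Continuous _ (Multiplicative (ZMod p)) _ ⊥ F} = 1 := by
  letI : TopologicalSpace (Multiplicative (ZMod p)) := ⊥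
  exact G.natCard_continuousMonoidHom_cuspFil_eq_one_of_eq h (Multiplicative (ZMod p))

omit [CompactSpace P'] [TotallyDisconnectedSpace P'] in
/-- **The hom-count of `M^cusp_{G_U}` to `ℤ/p` for a prime `p ∉ Σ_G` is `1`** (pro-`Σ_G` subquotient of
`Π_G`). [cite: MochizukiCombGC2007, Rmk 1.3.1 p.10] -/
theorem natCard_cuspFil_zmod_eq_one_of_not_mem (G : PSCDatum P) (U : Subgroup P)
    [((⁅U, U⁆.topologicalClosure).subgroupOf (G.cuspFil U)).Normal] {p : ℕ} (hp : p.Prime)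
    (hpS : p ∉ G.Sigma) :
    Nat.card {F : (G.cuspFil U ⧸ (⁅U, U⁆.topologicalClosure).subgroupOf (G.cuspFil U)) →*
      Multiplicative (ZMod p) // @Continuous _ (Multiplicative (ZMod p)) _ ⊥ F} = 1 :=
  natCard_continuousMonoidHom_zmod_eq_one_of_not_mem
    (fun M _ hM => G.isSigmaInteger_index_of_isOpen M hM) (G.cuspFil U) _ hp hpS

/-- **[CombGC] Theorem 1.6 (ii), the step "filtration-preserving ⟹ numerically cuspidal", NODE-FREE
data — from `CuspRank` and `NoncuspidalIffCuspFilTrivial` on the two sides only.**  Let `Π_G`, `Π_H` be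
profinite, `G`, `H` without nodes (any `Σ_G`, `Σ_H`), and assume Rmk. 1.3.1's second and third claims
for `G` and for `H`.  Then an edge-wise filtration-preserving `α : Π_G ⥲ Π_H` is numerically cuspidal:
`r(G_U) = r(H_{αU})` for every open `U`.  (`M^cusp_{G_U} ≅ M^cusp_{H_{αU}}`; if `G` is noncuspidal every
`M^cusp_{H_{V'}}` has hom-count `1` to `ℤ/q`, `q ∈ Σ_H`, hence vanishes, so `H` is noncuspidal, and
conversely; if both have cusps, comparing hom-counts to `ℤ/p` for `p ∈ Σ_G` and for `p ∈ Σ_H` gives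
`r(G_U) − 1 = r(H_{αU}) − 1`.)  Compare `isNumericallyCuspidal_of_isGraphicallyFiltrationPreserving_of_rankStatements`
(general data: sturdy, duality of ranks, common prime). [cite: MochizukiCombGC2007, Thm 1.6(ii) p.14] -/
theorem isNumericallyCuspidal_of_isEdgewiseFiltrationPreserving_of_cuspRank [IsEmpty G.graph.N]
    [IsEmpty H.graph.N] (hcG : G.CuspRank) (hnG : G.NoncuspidalIffCuspFilTrivial) (hcH : H.CuspRank)
    (hnH : H.NoncuspidalIffCuspFilTrivial) (hα : G.IsEdgewiseFiltrationPreserving H α) :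
    G.IsNumericallyCuspidal H α := by
  -- normality instances for closed `V` (both sides); images of open subgroups are open
  have nG : ∀ {V : Subgroup P}, IsClosed (V : Set P) →
      ((⁅V, V⁆.topologicalClosure).subgroupOf (G.cuspFil V)).Normal := fun hV =>
    normal_subgroupOf_of_commutator_le
      ((Subgroup.commutator_mono (G.cuspFil_le hV) (G.cuspFil_le hV)).trans
        (Subgroup.le_topologicalClosure _))
  have nH : ∀ {V' : Subgroup P'}, IsClosed (V' : Set P') →
      ((⁅V', V'⁆.topologicalClosure).subgroupOf (H.cuspFil V')).Normal := fun hV' =>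
    normal_subgroupOf_of_commutator_le
      ((Subgroup.commutator_mono (H.cuspFil_le hV') (H.cuspFil_le hV')).trans
        (Subgroup.le_topologicalClosure _))
  have himg : ∀ {V : Subgroup P}, IsOpen (V : Set P) →
      IsOpen ((V.map α.toMulEquiv.toMonoidHom : Subgroup P') : Set P') := fun {V} hV => by
    rw [Subgroup.coe_map]
    exact α.toHomeomorph.isOpenMap _ hV
  obtain ⟨p, hpG⟩ := G.sigma_nonempty
  have hp : p.Prime := G.sigma_prime p hpG
  obtain ⟨q, hqH⟩ := H.sigma_nonempty
  have hq : q.Prime := H.sigma_prime q hqH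
  -- `G` noncuspidal ⟹ `H` noncuspidal (hom-counts to `ℤ/q`, `q ∈ Σ_H`), and conversely (`ℤ/p`, `p ∈ Σ_G`)
  have ncH_of_ncG : G.graph.IsNoncuspidal → H.graph.IsNoncuspidal := fun hncG => by
    apply hnH.mpr
    intro V' hV'
    set V : Subgroup P := V'.comap α.toMulEquiv.toMonoidHom with hVdef
    have hV : IsOpen (V : Set P) := hV'.preimage α.continuous
    have hVmap : V.map α.toMulEquiv.toMonoidHom = V' :=
      Subgroup.map_comap_eq_self_of_surjective α.surjective _
    haveI := nG (Subgroup.isClosed_of_isOpen V hV)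
    haveI := nH (Subgroup.isClosed_of_isOpen _ (himg hV))
    letI : TopologicalSpace (Multiplicative (ZMod q)) := ⊥
    have h1 := natCard_cuspFil_eq_of_isEdgewiseFiltrationPreserving_of_isEmpty hα hV
      (Multiplicative (ZMod q))
    rw [G.natCard_cuspFil_zmod_eq_one_of_eq (hnG.mp hncG V hV) q] at h1
    have := H.cuspFil_eq_of_natCard_eq_one hcH (himg hV) hq hqH h1.symm
    rwa [hVmap] at this
  have ncG_of_ncH : H.graph.IsNoncuspidal → G.graph.IsNoncuspidal := fun hncH => by
    apply hnG.mpr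
    intro V hV
    haveI := nG (Subgroup.isClosed_of_isOpen V hV)
    haveI := nH (Subgroup.isClosed_of_isOpen _ (himg hV))
    letI : TopologicalSpace (Multiplicative (ZMod p)) := ⊥
    have h1 := natCard_cuspFil_eq_of_isEdgewiseFiltrationPreserving_of_isEmpty hα hV
      (Multiplicative (ZMod p))
    rw [H.natCard_cuspFil_zmod_eq_one_of_eq (hnH.mp hncH _ (himg hV)) p] at h1
    exact G.cuspFil_eq_of_natCard_eq_one hcG hV hp hpG h1
  -- the count at `U`
  intro U hU
  have hU'o := himg hU
  by_cases hcG0 : G.cuspCount U = 0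
  · rw [hcG0, eq_comm, H.cuspCount_eq_zero_iff_of_isOpen hU'o]
    exact ncH_of_ncG ((G.cuspCount_eq_zero_iff_of_isOpen hU).mp hcG0)
  by_cases hcH0 : H.cuspCount (U.map α.toMulEquiv.toMonoidHom) = 0
  · exact absurd ((G.cuspCount_eq_zero_iff_of_isOpen hU).mpr
      (ncG_of_ncH ((H.cuspCount_eq_zero_iff_of_isOpen hU'o).mp hcH0))) hcG0
  -- both counts positive: compare the hom-counts to `ℤ/p` (`p ∈ Σ_G`) and to `ℤ/q` (`q ∈ Σ_H`)
  have h0G := Nat.pos_of_ne_zero hcG0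
  have h0H := Nat.pos_of_ne_zero hcH0
  haveI := nG (Subgroup.isClosed_of_isOpen U hU)
  haveI := nH (Subgroup.isClosed_of_isOpen _ hU'o)
  letI : TopologicalSpace (Multiplicative (ZMod p)) := ⊥
  letI : TopologicalSpace (Multiplicative (ZMod q)) := ⊥
  -- transport along `α`, for the two primes
  have tp := natCard_cuspFil_eq_of_isEdgewiseFiltrationPreserving_of_isEmpty hα hU (Multiplicative (ZMod p))
  have tq := natCard_cuspFil_eq_of_isEdgewiseFiltrationPreserving_of_isEmpty hα hU (Multiplicative (ZMod q))
  rw [G.natCard_cuspFil_eq_pow hcG hU h0G hp hpG] at tp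
  rw [H.natCard_cuspFil_eq_pow hcH hU'o h0H hq hqH] at tq
  by_cases hpH : p ∈ H.Sigma
  · rw [H.natCard_cuspFil_eq_pow hcH hU'o h0H hp hpH] at tp
    have := Nat.pow_right_injective hp.two_le tp
    omega
  · -- `p ∉ Σ_H`: `p^{r(G_U)−1} = 1`, so `r(G_U) = 1`
    rw [H.natCard_cuspFil_zmod_eq_one_of_not_mem _ hp hpH] at tp
    have ha : G.cuspCount U - 1 = 0 := by
      by_contra hne
      have : 1 < p ^ (G.cuspCount U - 1) := Nat.one_lt_pow hne hp.one_lt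
      omega
    by_cases hqG : q ∈ G.Sigma
    · rw [G.natCard_cuspFil_eq_pow hcG hU h0G hq hqG] at tq
      have := Nat.pow_right_injective hq.two_le tq
      omega
    · -- `q ∉ Σ_G`: `r(H_{αU}) = 1` as well
      rw [G.natCard_cuspFil_zmod_eq_one_of_not_mem _ hq hqG] at tq
      have hb : H.cuspCount (U.map α.toMulEquiv.toMonoidHom) - 1 = 0 := by
        by_contra hne
        have : 1 < q ^ (H.cuspCount (U.map α.toMulEquiv.toMonoidHom) - 1) := Nat.one_lt_pow hne hq.one_lt
        omega
      omega

/-! ### Node-free one-vertex data: group-theoretically verticial / edge-like, and (ii) at one pair -/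

omit [IsTopologicalGroup P] [IsTopologicalGroup P'] [CompactSpace P] [TotallyDisconnectedSpace P]
  [CompactSpace P'] [TotallyDisconnectedSpace P'] in
/-- With `Π_v = Π` on both sides (a vertex present on each), every `α` is group-theoretically verticial:
the verticial subgroups are exactly `⊤`, and `α(⊤) = ⊤`. [cite: MochizukiCombGC2007, Def 1.4(iv) p.11] -/
theorem isGroupTheoreticallyVerticial_of_vertGp_eq_top (hV : ∀ v, G.vertGp v = ⊤) (v₀ : G.graph.V)
    (hW : ∀ w, H.vertGp w = ⊤) (w₀ : H.graph.V) (α : P ≃ₜ* P') : G.IsGroupTheoreticallyVerticial H α := by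
  have htop : (⊤ : Subgroup P).map α.toMulEquiv.toMonoidHom = ⊤ :=
    Subgroup.map_top_of_surjective _ α.surjective
  refine ⟨fun A hA => ?_, fun B hB => ⟨⊤, (G.isVerticial_iff_eq_top_of_vertGp_eq_top hV v₀ ⊤).mpr rfl, ?_⟩⟩
  · rw [(G.isVerticial_iff_eq_top_of_vertGp_eq_top hV v₀ A).mp hA, htop]
    exact (H.isVerticial_iff_eq_top_of_vertGp_eq_top hW w₀ ⊤).mpr rfl
  · rw [htop, ← (H.isVerticial_iff_eq_top_of_vertGp_eq_top hW w₀ B).mp hB]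

omit [IsTopologicalGroup P] [IsTopologicalGroup P'] [CompactSpace P] [TotallyDisconnectedSpace P]
  [CompactSpace P'] [TotallyDisconnectedSpace P'] in
/-- Without nodes on either side, group-theoretically cuspidal ⟹ group-theoretically edge-like (edge-like
= cuspidal). [cite: MochizukiCombGC2007, Def 1.4(iv) p.11] -/
theorem isGroupTheoreticallyEdgeLike_of_cuspidal_of_isEmpty [IsEmpty G.graph.N] [IsEmpty H.graph.N]
    (h : G.IsGroupTheoreticallyCuspidal H α) : G.IsGroupTheoreticallyEdgeLike H α := by
  refine ⟨fun A hA => Or.inr (h.1 A (hA.resolve_left (G.not_isNodal_of_isEmpty A))), fun B hB => ?_⟩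
  obtain ⟨A, hA, hAB⟩ := h.2 B (hB.resolve_left (H.not_isNodal_of_isEmpty B))
  exact ⟨A, Or.inr hA, hAB⟩

/-- **[CombGC] Theorem 1.6 (ii) at ONE pair of node-free one-vertex data, from FOUR inputs**: profinite
`Π_G`, `Π_H`, no nodes, `Π_v = Π` on both sides; the rank statements `CuspRank`,
`NoncuspidalIffCuspFilTrivial` for `G` and for `H`; Thm. 1.6 (i) at `(G, H, α)`; Prop. 1.5 (ii) at
`(G, H, α)`.  Then "`α` is graphic if and only if it is graphically filtration-preserving".
[cite: MochizukiCombGC2007, Thm 1.6(ii) p.13] -/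
theorem graphicIffGraphicallyFiltrationPreserving_of_nodeFree [IsEmpty G.graph.N] [IsEmpty H.graph.N]
    (hV : ∀ v, G.vertGp v = ⊤) (v₀ : G.graph.V) (hW : ∀ w, H.vertGp w = ⊤) (w₀ : H.graph.V)
    (hcG : G.CuspRank) (hnG : G.NoncuspidalIffCuspFilTrivial) (hcH : H.CuspRank)
    (hnH : H.NoncuspidalIffCuspFilTrivial) (h16i : G.NumericallyCuspidalIffGroupTheoreticallyCuspidal H α)
    (h15 : G.GraphicIffEdgeLikeVerticial H α) : G.GraphicIffGraphicallyFiltrationPreserving H α := by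
  refine ⟨G.isGraphicallyFiltrationPreserving_of_isGraphic H α, fun hα => h15.1.mpr ⟨?_, ?_⟩⟩
  · exact isGroupTheoreticallyEdgeLike_of_cuspidal_of_isEmpty
      (h16i.mp (isNumericallyCuspidal_of_isEdgewiseFiltrationPreserving_of_cuspRank hcG hnG hcH hnH hα.2))
  · exact isGroupTheoreticallyVerticial_of_vertGp_eq_top hV v₀ hW w₀ α

end NodeFree

/-! ### F-0444 over origins of node-free one-vertex data; the pro-`ℓ` genuine smooth-curve origins -/

section Origin

variable (Ω : PSCOrigin.{u})

/-- **[CombGC] Theorem 1.6 (ii) AS TYPED (F-0444 `GraphicIffFiltrationPreservingHolds Ω`) at every origin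
of NODE-FREE one-vertex data on profinite groups, from FOUR named origin statements** — `RankStatementsHold`
(F-3098; its `CuspRank` / `NoncuspidalIffCuspFilTrivial` conjuncts), `NumericallyCuspidalIffHolds` (F-0458,
Thm. 1.6 (i)), `GraphicIffEdgeLikeVerticialHolds` (F-0443, Prop. 1.5 (ii)) — for ALL `G`, `H` of `Ω`-type,
every `Σ_G`, `Σ_H`, every `α`.  Compare the thirteen-input `graphicIffFiltrationPreservingHolds_of_inputs''`.
[cite: MochizukiCombGC2007, Thm 1.6(ii) p.13] -/
theorem graphicIffFiltrationPreservingHolds_of_nodeFree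
    (hΩ : ∀ ⦃Q : Type u⦄ [Group Q] [TopologicalSpace Q] [IsTopologicalGroup Q] (G : PSCDatum Q),
      Ω.IsOfPSCType G → CompactSpace Q ∧ TotallyDisconnectedSpace Q ∧ IsEmpty G.graph.N ∧
        (∀ v, G.vertGp v = ⊤) ∧ Nonempty G.graph.V)
    (hrank : RankStatementsHold Ω) (h16i : NumericallyCuspidalIffHolds Ω)
    (h15 : GraphicIffEdgeLikeVerticialHolds Ω) : GraphicIffFiltrationPreservingHolds Ω := by
  intro Q _ _ _ Q' _ _ _ G H α hG hH
  obtain ⟨_, _, _, hV, ⟨v₀⟩⟩ := hΩ G hG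
  obtain ⟨_, _, _, hW, ⟨w₀⟩⟩ := hΩ H hH
  obtain ⟨-, -, hcG, hnG⟩ := hrank G hG
  obtain ⟨-, -, hcH, hnH⟩ := hrank H hH
  exact graphicIffGraphicallyFiltrationPreserving_of_nodeFree hV v₀ hW w₀ hcG hnG hcH hnH
    (h16i G H α hG hH) (h15 G H α hG hH)

/-- **F-0444 / [CombGC] Thm. 1.6 (ii) AS TYPED HOLDS at every pro-`ℓ` origin of GENUINE smooth-curve data,
closure-free form.**  Hypothesis = abc-iut-w5-d195's shape read OUTWARDS only: every `Ω`-datum lives on a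
profinite group, has no nodes, one vertex with `Π_v = Π`, `Σ = {ℓ}`, and is the smooth curve of a hyperbolic
type `(g, r)` along a pro-`Σ` completion `ι : Γ_{g,r} → Π`, cusp groups conjugates of `closure ι⟨c_{e c}⟩`,
`genus ≡ g` (all `(g, r)`, cusps allowed; NO closure of `Ω` under coverings / sturdy covers /
compactification is asked).  The four inputs of `graphicIffFiltrationPreservingHolds_of_nodeFree` are theorems
there: `rankStatementsHold_of_smoothCurveGenuine` (F-3098, abc-iut-w5-d195), `numericallyCuspidalIffHolds_of_smoothCurve'`
(F-0458, -w5-d195 over -f-164), `graphicIffEdgeLikeVerticialHolds_of_smoothCurve'` (F-0443, -w5-d195 over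
-w4-d081).  The inhabited covering-closed instance of record is abc-iut-w5-d174's
`exists_smoothCurveGenuineProLOrigin_thm16_inputs_hold` (thirteen-input route); this is route #2.
[cite: MochizukiCombGC2007, Thm 1.6(ii) p.13] -/
theorem graphicIffFiltrationPreservingHolds_of_smoothCurveGenuine (ℓ : ℕ)
    (hout : ∀ ⦃Q : Type u⦄ [Group Q] [TopologicalSpace Q] (G : PSCDatum Q), Ω.IsOfPSCType G →
      ∃ (_ : IsTopologicalGroup Q), CompactSpace Q ∧ T2Space Q ∧
        TotallyDisconnectedSpace Q ∧ IsEmpty G.graph.N ∧ (∀ v, G.vertGp v = ⊤) ∧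
        (∃ v₀ : G.graph.V, ∀ w, w = v₀) ∧ G.Sigma = {ℓ} ∧
        ∃ (g r : ℕ) (ι : PuncturedSurfaceGroup g r →* Q) (e : G.graph.C ≃ Fin r),
          IsHyperbolicType g r ∧ IsProSigmaCompletion G.Sigma ι ∧ (∀ v, G.genus v = g) ∧
          ∀ c, ∃ δ : ConjAct Q, G.cuspGp c = δ • ((cuspInertia (g := g) (e c)).map ι).topologicalClosure) :
    GraphicIffFiltrationPreservingHolds Ω := by
  have hΩ₁ : ∀ ⦃Q : Type u⦄ [Group Q] [TopologicalSpace Q] [IsTopologicalGroup Q] (G : PSCDatum Q),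
      Ω.IsOfPSCType G → CompactSpace Q ∧ T2Space Q ∧ TotallyDisconnectedSpace Q ∧ IsEmpty G.graph.N ∧
        (∀ v, G.vertGp v = ⊤) ∧ (∃ v₀ : G.graph.V, ∀ w, w = v₀) ∧
        ∃ (S : Set ℕ) (g r : ℕ) (ι : PuncturedSurfaceGroup g r →* Q) (e : G.graph.C ≃ Fin r),
          S.Nonempty ∧ (∀ p ∈ S, p.Prime) ∧ IsHyperbolicType g r ∧ IsProSigmaCompletion S ι ∧
          ∀ c, ∃ δ : ConjAct Q, G.cuspGp c =
            δ • ((cuspInertia (g := g) (e c)).map ι).topologicalClosure := by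
    intro Q _ _ _ G hG
    obtain ⟨_, hc, ht, hd, hN, hV, hv, -, g, r, ι, e, hgr, hι, -, hC⟩ := hout G hG
    exact ⟨hc, ht, hd, hN, hV, hv, G.Sigma, g, r, ι, e, G.sigma_nonempty, G.sigma_prime, hgr, hι, hC⟩
  refine graphicIffFiltrationPreservingHolds_of_nodeFree Ω (fun Q _ _ _ G hG => ?_)
    (rankStatementsHold_of_smoothCurveGenuine Ω fun Q _ _ _ G hG => ?_)
    (numericallyCuspidalIffHolds_of_smoothCurve' Ω ℓ (fun Q _ _ _ G hG => ?_) fun Q _ _ _ G hG => ?_)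
    (graphicIffEdgeLikeVerticialHolds_of_smoothCurve' Ω hΩ₁ fun Q _ _ G hG => ?_)
  · obtain ⟨_, hc, -, hd, hN, hV, ⟨v₀, -⟩, -⟩ := hout G hG
    exact ⟨hc, hd, hN, hV, ⟨v₀⟩⟩
  · obtain ⟨_, hc, ht, hd, hN, hV, hv, -, rest⟩ := hout G hG
    exact ⟨hc, ht, hd, hN, hV, hv, rest⟩
  · obtain ⟨h1, h2, h3, h4, -, h6, h7⟩ := hΩ₁ G hG
    exact ⟨h1, h2, h3, h4, h6, h7⟩
  · obtain ⟨_, -, -, -, -, -, -, hS, -⟩ := hout G hG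
    exact hS
  · obtain ⟨_, -, -, -, hN, hV, ⟨v₀, -⟩, -⟩ := hout G hG
    exact ⟨hN, hV, ⟨v₀⟩⟩

end Origin

end PSCDatum

end Literature.AnabelianGeometry.SemiGraphs

end
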